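import Mathlib.RepresentationTheory.Homological.GroupCohomology.LowDegree
import HarnessLib

/-!
# Sah's lemma: a central element acting as `−1` kills `H¹` (cell `b2b-bsdres`, team n1011,
# sub-target T-a3 "Kim 2026 Thm 1.8 (6) at p = 3", step S1 / hypothesis (H.3) at `p = 3`)

HONEST FRAMING (cell `b2b-bsdres`, run/shared/lean/b2b/bsd-rank1-residual/, verbatim in every
file): the goal of the cell is to DELETE the COMBINATION-SHAPED residual classes of the
Birch–Swinnerton-Dyer formula for ALL analytic-rank `≤ 1` elliptic curves over `ℚ` — "full BSD
formula for every rank `≤ 1` curve in class `C`" assembled STRICTLY from published theorems — so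
that the rank-`≤ 1` remainder becomes exactly the CONSTRUCTION-SHAPED classes, which are TYPED
(missing-input `Prop`s), NOT attempted. This is not "finishing BSD". Team n1011 (N10/N11, the
additive block `X4 ∧ p = 3`): research route; no claim beyond the stated classes; the label X4 and
the mark of RESIDUAL-MAP §I N11 are UNCHANGED by this file; nothing is booked. Theorems only: no
definition, no named fact (pure group cohomology over Mathlib's `groupCohomology`).

## What this file proves and why

Mazur–Rubin's hypothesis (H.3) for the Kolyvagin-system machine — in Rubin's wording (PCMI 18,
Lecture 2 §2.4): "`H¹(ℚ(A)/ℚ, Ā) = H¹(ℚ(A*)/ℚ, Ā*) = 0`" — and Sakamoto's third standing bullet at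
`p = 3` (Doc. Math. 27 (2022) App. §5: "`H¹(Gal(ℚ(μ_{3ⁿ}, T)/ℚ), T ⊗ 𝔽) = 0`") are, for `T = T₃E`
with 3-adically SURJECTIVE image (skeleton T-a3 binder (T); ROUTE-1 D3), instances of **Sah's
lemma**: if a group `G` acts `k`-linearly on `A`, `z ∈ G` is central and acts as `−1`, and `2` is
invertible in `k`, then every 1-cocycle is a 1-coboundary, so `H¹(G, A) = 0`. (For
`G = Gal(ℚ(E[3ᵏ])/ℚ) = GL₂(ℤ/3ᵏ)`, `A = E[3]` over `k = 𝔽₃`, `z = −1`.) Proof (4 lines, as in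
ROUTE-1 D3 / the lead's T-a3 row): for a cocycle `f`, `f(zg) = z·f(g) + f(z) = −f(g) + f(z)` and
`f(gz) = g·f(z) + f(g)`; since `zg = gz`, `2 f(g) = f(z) − g·f(z)`, i.e. `f = ∂v` with `v = −f(z)/2`.

* `coe_mem_coboundaries₁_of_central_of_actsAsNeg` — every 1-cocycle is a 1-coboundary;
* `H1π_eq_zero_of_central_of_actsAsNeg` — its class in `H¹(G, A)` is `0`;
* `H1_eq_zero_of_central_of_actsAsNeg` — every element of `H¹(G, A)` is `0`.

References: C.-H. Sah, *Automorphisms of finite groups*, J. Algebra 10 (1968) (the lemma);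
K. Rubin, PCMI 18 (2011) Lect. 2 §2.4 (H.3) [Rubin2011PCMI]; R. Sakamoto, Doc. Math. 27 (2022)
App. §5 [Sakamoto2022pSelmer]; B. Mazur, K. Rubin, Mem. AMS 799 (2004) §3.5 [MazurRubin2004].
-/

noncomputable section

universe u

namespace Summit.BirchSwinnertonDyer.Rank1Residual.Additive

open groupCohomology Rep

variable {k G : Type u} [CommRing k] [Group G] {A : Rep k G}

/-- **Sah's lemma, cocycle form.** If `z` is central in `G`, acts on `A` as `−1`, and `2 ∈ kˣ`,
then every 1-cocycle `f : G → A` is the coboundary of `v = −f(z)/2`: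
`f(g) = ρ(g)v − v`. [cite: Rubin2011PCMI, Lecture 2 §2.4 (H.3)] [cite: Sakamoto2022pSelmer, Appendix §5 (setting, third bullet)] -/
theorem coe_mem_coboundaries₁_of_central_of_actsAsNeg (z : G) (hz : ∀ g : G, g * z = z * g)
    (hρ : ∀ x : A, A.ρ z x = -x) (h2 : IsUnit (2 : k)) (f : cocycles₁ A) :
    (⇑f : G → A) ∈ coboundaries₁ A := by
  obtain ⟨u, hu⟩ := h2
  have hf := (mem_cocycles₁_iff (A := A) f).1 f.2
  -- the key identity `2 • f g = f z - ρ g (f z)`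
  have key : ∀ g : G, (2 : k) • f g = f z - A.ρ g (f z) := fun g => by
    have h1 : f (z * g) = A.ρ z (f g) + f z := hf z g
    have h2' : f (g * z) = A.ρ g (f z) + f g := hf g z
    rw [hz g, h1, hρ] at h2'
    -- h2' : -f g + f z = A.ρ g (f z) + f g
    rw [two_smul]
    have : f z - A.ρ g (f z) = f g + f g := by
      rw [sub_eq_iff_eq_add]
      calc f z = (-f g + f z) + f g := by abel
        _ = (A.ρ g (f z) + f g) + f g := by rw [h2']
        _ = f g + f g + A.ρ g (f z) := by abel
    exact this.symm
  refine ⟨-((↑u⁻¹ : k) • f z), funext fun g => ?_⟩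
  rw [d₀₁_hom_apply, map_neg, map_smul, neg_sub_neg, ← smul_sub, ← key g, smul_smul, ← hu,
    Units.inv_mul, one_smul]

/-- **Sah's lemma, class form**: under the same hypotheses the class of every 1-cocycle in
`H¹(G, A)` vanishes. [cite: Rubin2011PCMI, Lecture 2 §2.4 (H.3)] -/
theorem H1π_eq_zero_of_central_of_actsAsNeg (z : G) (hz : ∀ g : G, g * z = z * g)
    (hρ : ∀ x : A, A.ρ z x = -x) (h2 : IsUnit (2 : k)) (f : cocycles₁ A) :
    H1π A f = 0 :=
  (H1π_eq_zero_iff f).2 (coe_mem_coboundaries₁_of_central_of_actsAsNeg z hz hρ h2 f)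

/-- **Sah's lemma**: `H¹(G, A) = 0` when a central element of `G` acts on `A` as `−1` and `2` is
invertible in the coefficient ring — the form in which Mazur–Rubin's (H.3) and Sakamoto's `p = 3`
bullet are discharged for `E[3]` from `−1 ∈ ρ_{E,3^∞}(G_ℚ)` (3-adic tower surjectivity).
[cite: Rubin2011PCMI, Lecture 2 §2.4 (H.3)] [cite: Sakamoto2022pSelmer, Appendix §5] -/
theorem H1_eq_zero_of_central_of_actsAsNeg (z : G) (hz : ∀ g : G, g * z = z * g)
    (hρ : ∀ x : A, A.ρ z x = -x) (h2 : IsUnit (2 : k)) (x : H1 A) : x = 0 := by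
  induction x using H1_induction_on with
  | h f => exact H1π_eq_zero_of_central_of_actsAsNeg z hz hρ h2 f

end Summit.BirchSwinnertonDyer.Rank1Residual.Additive

end
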